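import Mathlib
import Summits.MatrixMultiplication.MatrixMultiplication.Theorems.SnSubsetDichotomyPolynomialSlackEntropyCertificate

/-!
# The mixed entropy certificate (product weights on positions AND on values)

Crux `Summit.MatrixMultiplication.MatrixMultiplication.Theses.SnSubsetDichotomy.PolynomialSlack`
(item `stmt-MatrixMultiplication-8306`), level-one programme, line transport-split-hull (lead c10).
The entropy certificate `log_density_ge_certificate` of `…EntropyCertificate` weighs a permutation
`π` by `∏_{k ∈ P} φ k (π k)` (blocks of VALUES at few POSITIONS).  The 3/4 step analyses the
sparse quotient `X = S⁻¹U` in both orientations at once — row hubs (blocks of values at few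
positions `k ∈ P`) and column hubs (blocks of positions at few values `v ∈ V`, i.e. weights
`ψ v (π⁻¹ v)`) — and the two families must share ONE entropy budget `log (n!/|X|)`.  This file
proves the mixed engine and certificate under the disjointness condition `φ k v = 1` for `k ∈ P`,
`v ∈ V` (row blocks avoid the hub values):

* `card_le_factorial_of_agree` — a set of permutations pairwise agreeing on `Q` has `≤ (n - |Q|)!`
  elements (one class of `card_filter_perm_restrict_eq_le_factorial`).
* `sum_prod_apply_le_of_agree` — the engine `sum_perm_prod_apply_le` restricted to a set `E` of
  permutations pairwise agreeing on a set `W` of positions disjoint from `P`: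
  `∑_{π ∈ E} ∏_{k ∈ P} φ k (π k) ≤ (n - |W| - |P|)! · ∏_{k ∈ P} ∑_w φ k w`.
* `sum_prod_apply_le_of_fibre` — the fibre bound: if all `π ∈ E` agree with `π₀` on `W = π₀⁻¹ V`
  (a fibre of `π ↦ π⁻¹|_V`), then `∑_{π ∈ E} ∏_{k ∈ P} φ k (π k) ≤ (n - |P| - |V|)! · ∏_k ∑_w φ k w`
  for `φ ≥ 1` with `φ k v ≤ 1` (`k ∈ P`, `v ∈ V`): the factors on `P ∩ W` are `≤ 1`, the restricted
  engine handles `P ∖ W`, and the dropped column sums `∑_w φ k w ≥ n` pay for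
  `(n - |V| - |P ∖ W|)! ≤ (n - |V| - |P|)! · n^{|P ∩ W|}`.
* `sum_perm_prod_mixed_le` — `(∑_π ∏_{k∈P} φ k (π k) · ∏_{v∈V} ψ v (π⁻¹ v)) · n^{(|P|+|V|)}
     ≤ (∏_{k∈P} ∑_w φ k w) · (∏_{v∈V} ∑_w ψ v w) · n!` for `φ ≥ 1`, `ψ ≥ 0`.
  Proof: group `π` by `g = π⁻¹|_V`; on the fibre `∏_v ψ v (π⁻¹ v) = ∏_v ψ v (g v)` is constant and
  the fibre bound applies uniformly in `g`; `∑_g ∏_v ψ v (g v) = ∏_v ∑_w ψ v w` (`Fintype.prod_sum`)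
  and `(n-|P|-|V|)! · n^{(|P|+|V|)} = n!` (`Nat.factorial_mul_descFactorial`).
* `log_density_ge_certificate_mixed` — for `X ≠ ∅`, `|P|+|V| < n`, `φ, ψ ≥ 1` and the disjointness,
  `(1/|X|) ∑_{x∈X} (∑_{k∈P} log φ k (x k) + ∑_{v∈V} log ψ v (x⁻¹ v))
     ≤ log (n!/|X|) + ∑_{k∈P} log ((∑_w φ k w)/n) + ∑_{v∈V} log ((∑_w ψ v w)/n)
       + (|P|+|V|) · log (n/(n-|P|-|V|))` (Jensen + density + the engine, as in the unmixed file).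
-/

set_option linter.dupNamespace false

open scoped BigOperators

namespace Summit.MatrixMultiplication.MatrixMultiplication.Theorems.PolynomialSlack

/-- **One class of prescribed values.** A set `E` of permutations of `Fin n` whose elements
pairwise agree on a set `Q` of positions has at most `(n - |Q|)!` elements: it is contained in the
class of `card_filter_perm_restrict_eq_le_factorial` of any of its members. [folklore] -/
theorem card_le_factorial_of_agree {n : ℕ} (Q : Finset (Fin n))
    (E : Finset (Equiv.Perm (Fin n))) (hE : ∀ π ∈ E, ∀ π' ∈ E, ∀ a ∈ Q, π a = π' a) :
    E.card ≤ (n - Q.card).factorial := by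
  classical
  rcases E.eq_empty_or_nonempty with hE0 | ⟨π₀, hπ₀⟩
  · rw [hE0, Finset.card_empty]
    exact Nat.zero_le _
  · refine (Finset.card_le_card fun π hπ => ?_).trans
      (card_filter_perm_restrict_eq_le_factorial Q fun k : ↥Q => π₀ k)
    exact Finset.mem_filter.2 ⟨Finset.mem_univ _, funext fun k => hE π hπ π₀ hπ₀ k k.2⟩

/-- **Restricted engine.** If the permutations of `E` pairwise agree on a set `W` of positions
disjoint from `P`, then for `φ ≥ 0`,
`∑_{π ∈ E} ∏_{k ∈ P} φ k (π k) ≤ (n - |W| - |P|)! · ∏_{k ∈ P} ∑_v φ k v`: group `π ∈ E` by its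
restriction to `P`; a class pairwise agrees on `W ∪ P` (`card_le_factorial_of_agree`), and the sum
over all maps `P → Fin n` of the product weight is the product of the column sums
(`Fintype.prod_sum`), exactly as in `sum_perm_prod_apply_le`. [folklore] -/
theorem sum_prod_apply_le_of_agree {n : ℕ} (P W : Finset (Fin n)) (hWP : Disjoint W P)
    (E : Finset (Equiv.Perm (Fin n))) (hE : ∀ π ∈ E, ∀ π' ∈ E, ∀ a ∈ W, π a = π' a)
    (φ : Fin n → Fin n → ℝ) (hφ : ∀ k v, 0 ≤ φ k v) :
    ∑ π ∈ E, ∏ k ∈ P, φ k (π k) ≤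
      ((n - (W.card + P.card)).factorial : ℝ) * ∏ k ∈ P, ∑ v : Fin n, φ k v := by
  classical
  -- the weight as a function of the restriction `f = π|_P : ↥P → Fin n`
  set g : (↥P → Fin n) → ℝ := fun f => ∏ k : ↥P, φ k (f k)
  have hg0 : ∀ f, 0 ≤ g f := fun f => Finset.prod_nonneg fun k _ => hφ _ _
  have h1 : ∑ π ∈ E, ∏ k ∈ P, φ k (π k) = ∑ π ∈ E, g (fun k : ↥P => π k) := by
    refine Finset.sum_congr rfl fun π _ => ?_
    exact (Finset.prod_coe_sort P (fun k => φ k (π k))).symm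
  -- group the permutations of `E` by their restriction to `P`
  have h2 : ∑ π ∈ E, g (fun k : ↥P => π k)
      = ∑ b : ↥P → Fin n, ((E.filter fun π : Equiv.Perm (Fin n) =>
          (fun k : ↥P => π k) = b).card : ℝ) * g b := by
    rw [← Finset.sum_fiberwise' E (fun π : Equiv.Perm (Fin n) => fun k : ↥P => π k) g]
    simp only [Finset.sum_const, nsmul_eq_mul]
  -- each class pairwise agrees on `W ∪ P`, hence has at most `(n - |W| - |P|)!` elements
  have hWP' : (W ∪ P).card = W.card + P.card := Finset.card_union_of_disjoint hWP
  have h3 : ∑ b : ↥P → Fin n, ((E.filter fun π : Equiv.Perm (Fin n) =>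
          (fun k : ↥P => π k) = b).card : ℝ) * g b
      ≤ ∑ b : ↥P → Fin n, ((n - (W.card + P.card)).factorial : ℝ) * g b := by
    refine Finset.sum_le_sum fun b _ => mul_le_mul_of_nonneg_right ?_ (hg0 b)
    rw [← hWP']
    exact_mod_cast card_le_factorial_of_agree (W ∪ P) _ fun π hπ π' hπ' a ha => by
      rcases Finset.mem_union.1 ha with haW | haP
      · exact hE π (Finset.mem_filter.1 hπ).1 π' (Finset.mem_filter.1 hπ').1 a haW
      · have e1 := congrFun (Finset.mem_filter.1 hπ).2 ⟨a, haP⟩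
        have e2 := congrFun (Finset.mem_filter.1 hπ').2 ⟨a, haP⟩
        simp only at e1 e2
        rw [e1, e2]
  -- the sum over ALL maps of the product weight is the product of the column sums
  have h4 : ∑ b : ↥P → Fin n, ((n - (W.card + P.card)).factorial : ℝ) * g b
      = ((n - (W.card + P.card)).factorial : ℝ) * ∏ k ∈ P, ∑ v : Fin n, φ k v := by
    rw [← Finset.mul_sum, ← Finset.prod_coe_sort P, Fintype.prod_sum]
  rw [h1, h2]
  exact h3.trans h4.le

/-- `(a + j)! ≤ a! · n ^ j` whenever `a + j ≤ n` (each of the `j` extra factors is `≤ n`). -/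
private theorem factorial_add_le_factorial_mul_pow {a j n : ℕ} (h : a + j ≤ n) :
    (a + j).factorial ≤ a.factorial * n ^ j := by
  rw [← Nat.factorial_mul_descFactorial (Nat.le_add_left j a), Nat.add_sub_cancel]
  exact Nat.mul_le_mul_left _
    ((Nat.descFactorial_le_pow _ _).trans (Nat.pow_le_pow_left h _))

/-- **Fibre bound.** Let `φ ≥ 1` with `φ k v ≤ 1` for `k ∈ P`, `v ∈ V`, let `|P| + |V| ≤ n`, and
let `E` be a set of permutations that all agree with `π₀` at every position `k` with `π₀ k ∈ V`
(for instance a fibre of `π ↦ π⁻¹|_V`).  Then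
`∑_{π ∈ E} ∏_{k ∈ P} φ k (π k) ≤ (n - |P| - |V|)! · ∏_{k ∈ P} ∑_w φ k w`.
Proof: put `W = π₀⁻¹ V` (`|W| = |V|`); for `π ∈ E` and `k ∈ P ∩ W` the factor `φ k (π k) =
φ k (π₀ k)` has `π₀ k ∈ V`, so it is `≤ 1` and may be dropped (`φ ≥ 0`); the restricted engine
`sum_prod_apply_le_of_agree` bounds the rest by `(n - |V| - |P ∖ W|)! · ∏_{k ∈ P ∖ W} ∑_w φ k w`;
finally `(n - |V| - |P ∖ W|)! ≤ (n - |V| - |P|)! · n^{|P ∩ W|}` and `n^{|P ∩ W|} ≤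
∏_{k ∈ P ∩ W} ∑_w φ k w` (`φ ≥ 1`) restore the dropped factors. [folklore] -/
theorem sum_prod_apply_le_of_fibre {n : ℕ} (P V : Finset (Fin n)) (φ : Fin n → Fin n → ℝ)
    (hφ : ∀ k w, 1 ≤ φ k w) (hdisj : ∀ k ∈ P, ∀ v ∈ V, φ k v ≤ 1) (hle : P.card + V.card ≤ n)
    (E : Finset (Equiv.Perm (Fin n))) (π₀ : Equiv.Perm (Fin n))
    (hE : ∀ π ∈ E, ∀ k, π₀ k ∈ V → π k = π₀ k) :
    ∑ π ∈ E, ∏ k ∈ P, φ k (π k) ≤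
      ((n - (P.card + V.card)).factorial : ℝ) * ∏ k ∈ P, ∑ w : Fin n, φ k w := by
  classical
  have hφ0 : ∀ k w, 0 ≤ φ k w := fun k w => zero_le_one.trans (hφ k w)
  -- the positions sent into `V` (by `π₀`, equivalently by any `π ∈ E`)
  obtain ⟨W, hW, hWc⟩ : ∃ W : Finset (Fin n), (∀ k, k ∈ W ↔ π₀ k ∈ V) ∧ W.card = V.card :=
    ⟨V.map π₀.symm.toEmbedding, fun k => by rw [Finset.mem_map_equiv, Equiv.symm_symm],
      Finset.card_map _⟩
  -- the column sums `S k = ∑_w φ k w ≥ n`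
  set S : Fin n → ℝ := fun k => ∑ w, φ k w
  have hSn : ∀ k, (n : ℝ) ≤ S k := fun k => by
    have h := Finset.card_nsmul_le_sum Finset.univ (φ k) 1 fun v _ => hφ k v
    rwa [Finset.card_univ, Fintype.card_fin, nsmul_eq_mul, mul_one] at h
  have hS0 : ∀ k, 0 ≤ S k := fun k => (Nat.cast_nonneg n).trans (hSn k)
  -- (a) drop the factors on `P ∩ W`, each `≤ 1`
  have ha : ∑ π ∈ E, ∏ k ∈ P, φ k (π k) ≤ ∑ π ∈ E, ∏ k ∈ P \ W, φ k (π k) := by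
    refine Finset.sum_le_sum fun π hπ => ?_
    rw [← Finset.prod_inter_mul_prod_sdiff P W]
    refine mul_le_of_le_one_left (Finset.prod_nonneg fun k _ => hφ0 _ _)
      (Finset.prod_le_one (fun k _ => hφ0 _ _) fun k hk => ?_)
    have hkV : π₀ k ∈ V := (hW k).1 (Finset.mem_inter.1 hk).2
    rw [hE π hπ k hkV]
    exact hdisj k (Finset.mem_inter.1 hk).1 _ hkV
  -- (b) the restricted engine on `P ∖ W` (the permutations of `E` pairwise agree on `W`)
  have hb : ∑ π ∈ E, ∏ k ∈ P \ W, φ k (π k) ≤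
      ((n - (W.card + (P \ W).card)).factorial : ℝ) * ∏ k ∈ P \ W, S k :=
    sum_prod_apply_le_of_agree (P \ W) W Finset.disjoint_sdiff E
      (fun π hπ π' hπ' a ha => by rw [hE π hπ a ((hW a).1 ha), hE π' hπ' a ((hW a).1 ha)]) φ hφ0
  -- (c) restore the dropped factors
  have hcard : (P \ W).card + (P ∩ W).card = P.card := Finset.card_sdiff_add_card_inter P W
  have hc1 : ((n - (W.card + (P \ W).card)).factorial : ℝ) ≤
      ((n - (P.card + V.card)).factorial : ℝ) * (n : ℝ) ^ (P ∩ W).card := by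
    have haj : n - (W.card + (P \ W).card) = (n - (P.card + V.card)) + (P ∩ W).card := by omega
    have key := factorial_add_le_factorial_mul_pow (a := n - (P.card + V.card))
      (j := (P ∩ W).card) (n := n) (by omega)
    rw [← haj] at key
    exact_mod_cast key
  have hc2 : (n : ℝ) ^ (P ∩ W).card ≤ ∏ k ∈ P ∩ W, S k := by
    rw [← Finset.prod_const]
    exact Finset.prod_le_prod (fun _ _ => Nat.cast_nonneg _) fun k _ => hSn k
  have hc : ((n - (W.card + (P \ W).card)).factorial : ℝ) * ∏ k ∈ P \ W, S k ≤
      ((n - (P.card + V.card)).factorial : ℝ) * ∏ k ∈ P, S k :=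
    calc ((n - (W.card + (P \ W).card)).factorial : ℝ) * ∏ k ∈ P \ W, S k
        ≤ (((n - (P.card + V.card)).factorial : ℝ) * (n : ℝ) ^ (P ∩ W).card) *
            ∏ k ∈ P \ W, S k :=
          mul_le_mul_of_nonneg_right hc1 (Finset.prod_nonneg fun k _ => hS0 k)
      _ ≤ (((n - (P.card + V.card)).factorial : ℝ) * ∏ k ∈ P ∩ W, S k) * ∏ k ∈ P \ W, S k :=
          mul_le_mul_of_nonneg_right (mul_le_mul_of_nonneg_left hc2 (Nat.cast_nonneg _))
            (Finset.prod_nonneg fun k _ => hS0 k)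
      _ = ((n - (P.card + V.card)).factorial : ℝ) * ∏ k ∈ P, S k := by
          rw [mul_assoc, Finset.prod_inter_mul_prod_sdiff]
  exact ha.trans (hb.trans hc)

/-- **Mixed product weights: the uniform engine.**  For positions `P`, values `V`, weights `φ ≥ 1`
on (position, value) and `ψ ≥ 0` on (value, position) with `φ k v = 1`... precisely `φ k v ≤ 1` for
`k ∈ P`, `v ∈ V`:
`(∑_π ∏_{k∈P} φ k (π k) · ∏_{v∈V} ψ v (π⁻¹ v)) · n^{(|P|+|V|)} ≤ (∏_{k∈P} ∑_w φ k w)(∏_{v∈V} ∑_w ψ v w) · n!`.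
[folklore] -/
theorem sum_perm_prod_mixed_le {n : ℕ} (P V : Finset (Fin n)) (φ ψ : Fin n → Fin n → ℝ)
    (hφ : ∀ k w, 1 ≤ φ k w) (hψ : ∀ v w, 0 ≤ ψ v w) (hdisj : ∀ k ∈ P, ∀ v ∈ V, φ k v ≤ 1) :
    (∑ π : Equiv.Perm (Fin n), (∏ k ∈ P, φ k (π k)) * ∏ v ∈ V, ψ v (π⁻¹ v)) *
        (n.descFactorial (P.card + V.card) : ℝ) ≤
      ((∏ k ∈ P, ∑ w : Fin n, φ k w) * ∏ v ∈ V, ∑ w : Fin n, ψ v w) * (n.factorial : ℝ) := by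
  classical
  have hφ0 : ∀ k w, 0 ≤ φ k w := fun k w => zero_le_one.trans (hφ k w)
  have hS0 : 0 ≤ ∏ k ∈ P, ∑ w : Fin n, φ k w :=
    Finset.prod_nonneg fun k _ => Finset.sum_nonneg fun w _ => hφ0 k w
  rcases Nat.lt_or_ge n (P.card + V.card) with hlt | hle
  · -- degenerate case: `n^{(|P|+|V|)} = 0`
    rw [Nat.descFactorial_eq_zero_iff_lt.2 hlt, Nat.cast_zero, mul_zero]
    exact mul_nonneg (mul_nonneg hS0
      (Finset.prod_nonneg fun v _ => Finset.sum_nonneg fun w _ => hψ v w)) (Nat.cast_nonneg _)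
  · -- the value weight as a function of the restriction `g = π⁻¹|_V : ↥V → Fin n`
    set Ψ : (↥V → Fin n) → ℝ := fun g => ∏ v : ↥V, ψ v (g v)
    have hΨ0 : ∀ g, 0 ≤ Ψ g := fun g => Finset.prod_nonneg fun v _ => hψ _ _
    set ρ : Equiv.Perm (Fin n) → (↥V → Fin n) := fun π => fun v : ↥V => π⁻¹ v with hρ
    set C : ℝ := ((n - (P.card + V.card)).factorial : ℝ) * ∏ k ∈ P, ∑ w : Fin n, φ k w with hC
    have h1 : ∑ π : Equiv.Perm (Fin n), (∏ k ∈ P, φ k (π k)) * ∏ v ∈ V, ψ v (π⁻¹ v)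
        = ∑ π : Equiv.Perm (Fin n), (∏ k ∈ P, φ k (π k)) * Ψ (ρ π) := by
      refine Finset.sum_congr rfl fun π _ => ?_
      rw [← Finset.prod_coe_sort V]
    -- group the permutations by `ρ π = π⁻¹|_V`; on a fibre the value weight is constant
    have h2 : ∑ π : Equiv.Perm (Fin n), (∏ k ∈ P, φ k (π k)) * Ψ (ρ π)
        = ∑ g : ↥V → Fin n, (∑ π ∈ Finset.univ.filter (fun π : Equiv.Perm (Fin n) => ρ π = g),
            ∏ k ∈ P, φ k (π k)) * Ψ g := by
      rw [← Finset.sum_fiberwise Finset.univ ρ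
        (fun π : Equiv.Perm (Fin n) => (∏ k ∈ P, φ k (π k)) * Ψ (ρ π))]
      refine Finset.sum_congr rfl fun g _ => ?_
      rw [Finset.sum_mul]
      refine Finset.sum_congr rfl fun π hπ => ?_
      rw [(Finset.mem_filter.1 hπ).2]
    -- the fibre bound, uniformly in `g`
    have h3 : ∀ g : ↥V → Fin n,
        (∑ π ∈ Finset.univ.filter (fun π : Equiv.Perm (Fin n) => ρ π = g),
          ∏ k ∈ P, φ k (π k)) * Ψ g ≤ C * Ψ g := by
      intro g
      refine mul_le_mul_of_nonneg_right ?_ (hΨ0 g)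
      rcases (Finset.univ.filter fun π : Equiv.Perm (Fin n) => ρ π = g).eq_empty_or_nonempty
        with hE | ⟨π₀, hπ₀⟩
      · rw [hE, Finset.sum_empty, hC]
        exact mul_nonneg (Nat.cast_nonneg _) hS0
      · refine sum_prod_apply_le_of_fibre P V φ hφ hdisj hle _ π₀ fun π hπ k hk => ?_
        -- `π⁻¹ (π₀ k) = g ⟨π₀ k, _⟩ = π₀⁻¹ (π₀ k) = k`
        have e1 := congrFun (Finset.mem_filter.1 hπ).2 ⟨π₀ k, hk⟩
        have e2 := congrFun (Finset.mem_filter.1 hπ₀).2 ⟨π₀ k, hk⟩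
        simp only [hρ, Equiv.Perm.inv_def, Equiv.symm_apply_apply] at e1 e2
        rw [← e2, Equiv.symm_apply_eq] at e1
        exact e1.symm
    -- sum over all `g`: the product of the column sums of `ψ`
    have h4 : ∑ g : ↥V → Fin n, C * Ψ g = C * ∏ v ∈ V, ∑ w : Fin n, ψ v w := by
      rw [← Finset.mul_sum, ← Finset.prod_coe_sort V, Fintype.prod_sum]
    have h5 : ((n - (P.card + V.card)).factorial : ℝ) * (n.descFactorial (P.card + V.card) : ℝ)
        = (n.factorial : ℝ) := by
      exact_mod_cast Nat.factorial_mul_descFactorial hle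
    calc (∑ π : Equiv.Perm (Fin n), (∏ k ∈ P, φ k (π k)) * ∏ v ∈ V, ψ v (π⁻¹ v)) *
          (n.descFactorial (P.card + V.card) : ℝ)
        ≤ (C * ∏ v ∈ V, ∑ w : Fin n, ψ v w) * (n.descFactorial (P.card + V.card) : ℝ) := by
          refine mul_le_mul_of_nonneg_right ?_ (Nat.cast_nonneg _)
          rw [h1, h2, ← h4]
          exact Finset.sum_le_sum fun g _ => h3 g
      _ = ((∏ k ∈ P, ∑ w : Fin n, φ k w) * ∏ v ∈ V, ∑ w : Fin n, ψ v w) * (n.factorial : ℝ) := by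
          rw [hC, ← h5]
          ring

/-- **Mixed entropy certificate for the co-density of a subset of `S_n`.**  Let `X ⊆ S_n` be
non-empty, `P` (positions) and `V` (values) with `|P| + |V| < n`, weights `φ, ψ ≥ 1` with
`φ k v = 1` whenever `k ∈ P`, `v ∈ V`.  Then
`(1/|X|) ∑_{x ∈ X} (∑_{k ∈ P} log φ k (x k) + ∑_{v ∈ V} log ψ v (x⁻¹ v))
   ≤ log (n!/|X|) + ∑_{k ∈ P} log ((∑_w φ k w)/n) + ∑_{v ∈ V} log ((∑_w ψ v w)/n)
     + (|P| + |V|) · log (n/(n - |P| - |V|))`. [folklore] -/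
theorem log_density_ge_certificate_mixed {n : ℕ} (X : Finset (Equiv.Perm (Fin n)))
    (hX : X.Nonempty) (P V : Finset (Fin n)) (hPV : P.card + V.card < n)
    (φ ψ : Fin n → Fin n → ℝ) (hφ : ∀ k w, 1 ≤ φ k w) (hψ : ∀ v w, 1 ≤ ψ v w)
    (hdisj : ∀ k ∈ P, ∀ v ∈ V, φ k v ≤ 1) :
    (∑ x ∈ X, ((∑ k ∈ P, Real.log (φ k (x k))) + ∑ v ∈ V, Real.log (ψ v (x⁻¹ v)))) / X.card ≤
      Real.log ((n.factorial : ℝ) / X.card) + ∑ k ∈ P, Real.log ((∑ w : Fin n, φ k w) / n) +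
        ∑ v ∈ V, Real.log ((∑ w : Fin n, ψ v w) / n) +
        (P.card + V.card : ℕ) * Real.log ((n : ℝ) / (n - (P.card + V.card : ℕ))) := by
  classical
  -- the mixed engine (before `|P| + |V|` is abbreviated)
  have hmix := sum_perm_prod_mixed_le P V φ ψ hφ (fun v w => zero_le_one.trans (hψ v w)) hdisj
  set r : ℕ := P.card + V.card with hr
  -- positivity bookkeeping
  have hφ0 : ∀ k w, 0 < φ k w := fun k w => one_pos.trans_le (hφ k w)
  have hψ0 : ∀ v w, 0 < ψ v w := fun v w => one_pos.trans_le (hψ v w)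
  have hnR : (0 : ℝ) < n := Nat.cast_pos.2 (lt_of_le_of_lt (Nat.zero_le _) hPV)
  have hXc : (0 : ℝ) < X.card := Nat.cast_pos.2 hX.card_pos
  have hnr : (0 : ℝ) < (n : ℝ) - r := by
    rw [sub_pos]
    exact_mod_cast hPV
  have hfac : (0 : ℝ) < n.factorial := Nat.cast_pos.2 n.factorial_pos
  -- the weight `Z π = ∏_{k ∈ P} φ k (π k) · ∏_{v ∈ V} ψ v (π⁻¹ v) > 0` and the column sums
  set Z : Equiv.Perm (Fin n) → ℝ := fun π => (∏ k ∈ P, φ k (π k)) * ∏ v ∈ V, ψ v (π⁻¹ v)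
  have hZpos : ∀ π, 0 < Z π := fun π =>
    mul_pos (Finset.prod_pos fun k _ => hφ0 k (π k)) (Finset.prod_pos fun v _ => hψ0 v (π⁻¹ v))
  set S : Fin n → ℝ := fun k => ∑ w, φ k w
  set T : Fin n → ℝ := fun v => ∑ w, ψ v w
  have hSpos : ∀ k, 0 < S k := fun k => by
    refine hnR.trans_le ?_
    have h := Finset.card_nsmul_le_sum Finset.univ (φ k) 1 fun v _ => hφ k v
    rwa [Finset.card_univ, Fintype.card_fin, nsmul_eq_mul, mul_one] at h
  have hTpos : ∀ v, 0 < T v := fun v => by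
    refine hnR.trans_le ?_
    have h := Finset.card_nsmul_le_sum Finset.univ (ψ v) 1 fun w _ => hψ v w
    rwa [Finset.card_univ, Fintype.card_fin, nsmul_eq_mul, mul_one] at h
  -- (a) the left-hand side is the `X`-average of `log Z` ...
  have hlogZ : ∀ π, Real.log (Z π) =
      (∑ k ∈ P, Real.log (φ k (π k))) + ∑ v ∈ V, Real.log (ψ v (π⁻¹ v)) := fun π => by
    rw [Real.log_mul (Finset.prod_pos fun k _ => hφ0 k (π k)).ne'
        (Finset.prod_pos fun v _ => hψ0 v (π⁻¹ v)).ne',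
      Real.log_prod fun k _ => (hφ0 k (π k)).ne', Real.log_prod fun v _ => (hψ0 v (π⁻¹ v)).ne']
  have hLHS : (∑ x ∈ X, ((∑ k ∈ P, Real.log (φ k (x k))) +
      ∑ v ∈ V, Real.log (ψ v (x⁻¹ v)))) / X.card = ∑ x ∈ X, (X.card : ℝ)⁻¹ • Real.log (Z x) := by
    rw [div_eq_inv_mul, Finset.mul_sum]
    simp only [smul_eq_mul, hlogZ]
  -- ... which Jensen (the concavity of `log` on `(0, ∞)`) bounds by `log` of the average of `Z`
  have hJ : ∑ x ∈ X, (X.card : ℝ)⁻¹ • Real.log (Z x) ≤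
      Real.log (∑ x ∈ X, (X.card : ℝ)⁻¹ • Z x) :=
    strictConcaveOn_log_Ioi.concaveOn.le_map_sum (fun _ _ => inv_nonneg.2 hXc.le)
      (by rw [Finset.sum_const, nsmul_eq_mul, mul_inv_cancel₀ hXc.ne']) fun x _ => hZpos x
  have hApos : 0 < ∑ x ∈ X, (X.card : ℝ)⁻¹ • Z x := by
    rw [← Finset.smul_sum, smul_eq_mul]
    exact mul_pos (inv_pos.2 hXc) (Finset.sum_pos (fun π _ => hZpos π) hX)
  -- (b) density `∑_X Z ≤ ∑_{S_n} Z`, (c) the mixed engine, and `(n - r)^r ≤ n^(r)`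
  have hsumX : ∑ x ∈ X, Z x ≤ ∑ π, Z π :=
    Finset.sum_le_univ_sum_of_nonneg fun π => (hZpos π).le
  have hdesc : ((n : ℝ) - r) ^ r ≤ (n.descFactorial r : ℝ) := by
    have h := (Nat.pow_le_pow_left (Nat.sub_le_sub_right n.le_succ r) r).trans
      (Nat.pow_sub_le_descFactorial n r)
    rw [← show ((n - r : ℕ) : ℝ) = (n : ℝ) - r from Nat.cast_sub hPV.le]
    exact_mod_cast h
  have hkey : (∑ x ∈ X, Z x) * ((n : ℝ) - r) ^ r ≤
      ((∏ k ∈ P, S k) * ∏ v ∈ V, T v) * n.factorial :=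
    calc (∑ x ∈ X, Z x) * ((n : ℝ) - r) ^ r
        ≤ (∑ π, Z π) * (n.descFactorial r : ℝ) :=
          mul_le_mul hsumX hdesc (pow_nonneg hnr.le _)
            (Finset.sum_nonneg fun π _ => (hZpos π).le)
      _ ≤ ((∏ k ∈ P, S k) * ∏ v ∈ V, T v) * n.factorial := hmix
  -- (d) the right-hand side is the `log` of one product `B`, and the average of `Z` is `≤ B`
  have h1 : (0 : ℝ) < (n.factorial : ℝ) / X.card := div_pos hfac hXc
  have h2 : (0 : ℝ) < ∏ k ∈ P, S k / n := Finset.prod_pos fun k _ => div_pos (hSpos k) hnR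
  have h3 : (0 : ℝ) < ∏ v ∈ V, T v / n := Finset.prod_pos fun v _ => div_pos (hTpos v) hnR
  have h4 : (0 : ℝ) < ((n : ℝ) / (n - r)) ^ r := pow_pos (div_pos hnR hnr) _
  have hRHS : Real.log ((n.factorial : ℝ) / X.card) + ∑ k ∈ P, Real.log (S k / n) +
      ∑ v ∈ V, Real.log (T v / n) + (r : ℝ) * Real.log ((n : ℝ) / (n - r)) =
        Real.log ((n.factorial : ℝ) / X.card * (∏ k ∈ P, S k / n) * (∏ v ∈ V, T v / n) *
          ((n : ℝ) / (n - r)) ^ r) := by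
    rw [Real.log_mul (mul_pos (mul_pos h1 h2) h3).ne' h4.ne',
      Real.log_mul (mul_pos h1 h2).ne' h3.ne', Real.log_mul h1.ne' h2.ne',
      Real.log_prod fun k _ => (div_pos (hSpos k) hnR).ne',
      Real.log_prod fun v _ => (div_pos (hTpos v) hnR).ne', Real.log_pow]
  have hprod : (∏ k ∈ P, S k / n) * (∏ v ∈ V, T v / n) =
      ((∏ k ∈ P, S k) * ∏ v ∈ V, T v) / (n : ℝ) ^ r := by
    rw [Finset.prod_div_distrib, Finset.prod_div_distrib, Finset.prod_const, Finset.prod_const,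
      hr, pow_add, div_mul_div_comm]
  have hB : (n.factorial : ℝ) / X.card * (∏ k ∈ P, S k / n) * (∏ v ∈ V, T v / n) *
      ((n : ℝ) / (n - r)) ^ r =
        ((∏ k ∈ P, S k) * ∏ v ∈ V, T v) * n.factorial / (X.card * ((n : ℝ) - r) ^ r) := by
    rw [mul_assoc ((n.factorial : ℝ) / X.card), hprod, div_pow]
    field_simp
  have hA : ∑ x ∈ X, (X.card : ℝ)⁻¹ • Z x =
      (∑ x ∈ X, Z x) * ((n : ℝ) - r) ^ r / (X.card * ((n : ℝ) - r) ^ r) := by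
    rw [← Finset.smul_sum, smul_eq_mul]
    field_simp
  -- assemble
  rw [hLHS, hRHS]
  refine hJ.trans (Real.log_le_log hApos ?_)
  rw [hB, hA]
  exact div_le_div_of_nonneg_right hkey (mul_pos hXc (pow_pos hnr _)).le

end Summit.MatrixMultiplication.MatrixMultiplication.Theorems.PolynomialSlack
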